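import Mathlib
import Literature.MeasureTheory.Integral.HPolyhedronTopFacets
import HarnessLib

/-!
# Graph integrals over a facet plane versus isometric facet charts (the Jacobian `|c|/‖n‖`)

Topic `Literature/MeasureTheory/Integral`; namespace `Literature.MeasureTheory.Integral`.
Continuation of `HPolyhedronVerticalFibres` / `HPolyhedronTopFacets` (bricks L2–L3 of the facet-formula
programme, crystal3d-full eng MEMO-5 §B): there the vertical Gauss–Green integral over an H-polyhedron
`{(x,t) | ∀ j, A j x + c j t ≤ b j}` was written as a sum, over the active constraints, of GRAPH integrals
`∫_{D_j} g(x, (b_j − A_j x)/c_j) dx` over planar pieces `D_j ⊆ ℝ × ℝ`.  This file (brick L4) converts such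
a graph integral into an integral over an ISOMETRIC CHART of the facet plane
`Π = {(x,t) | α x₁ + β x₂ + c t = b}` (`c ≠ 0`): if `p₀ ∈ Π` and `u, v` is an orthonormal pair of
directions of `Π` (unit, mutually orthogonal, orthogonal to the normal `n = (α, β, c)` — all in coordinates),
then for every measurable `S ⊆ ℝ × ℝ` and every `g`,
`∫_{x ∈ S} g(x, (b − αx₁ − βx₂)/c) dx = (|c|/‖n‖) · ∫_{y ∈ ℝ²} 1_S(π(φ y)) g(φ y) dy`,
`φ y = p₀ + y₁u + y₂v`, `π` the horizontal projection (`setIntegral_graph_eq_mul_integral_chart`).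
Ingredients: the affine change of variables `x = π(φ y)` on `ℝ × ℝ`
(`integral_eq_abs_det_mul_integral_comp_add`, from Mathlib's
`integral_image_eq_integral_abs_det_fderiv_smul`) and the frame identity
`(u₁v₂ − u₂v₁)²‖n‖² = c²` (`sq_frameDet_mul_normSq`: the third component of `u × v = ±n/‖n‖`).
With `‖n‖ = 1` the factor is `|c_j| = |⟪a_j, e⟫|`, so that summing the three coordinate directions turns
the piece sums of `setIntegral_deriv_hPolyhedron_eq_sum` into facet integrals `∫_{F_j} ⟪η, a_j⟫ dσ`
(brick T1, not done here).
-/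

noncomputable section

namespace Literature.MeasureTheory.Integral

open _root_.MeasureTheory Set

/-! ### The frame identity -/

/-- For an orthonormal pair `u, v ⊥ n = (α, β, c)` in `ℝ³` (coordinates): `(u₁v₂ − u₂v₁)²·‖n‖² = c²`
(the third component of the unit vector `u × v = ±n/‖n‖`).
[cite: EvansGariepy2015, Thm 5.16 (Gauss–Green), facet charts — plumbing] -/
theorem sq_frameDet_mul_normSq (u1 u2 u3 v1 v2 v3 α β c : ℝ)
    (hu : u1 ^ 2 + u2 ^ 2 + u3 ^ 2 = 1) (hv : v1 ^ 2 + v2 ^ 2 + v3 ^ 2 = 1)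
    (huv : u1 * v1 + u2 * v2 + u3 * v3 = 0)
    (hnu : α * u1 + β * u2 + c * u3 = 0) (hnv : α * v1 + β * v2 + c * v3 = 0) :
    (u1 * v2 - u2 * v1) ^ 2 * (α ^ 2 + β ^ 2 + c ^ 2) = c ^ 2 := by
  have hw : (u2 * v3 - u3 * v2) ^ 2 + (u3 * v1 - u1 * v3) ^ 2 + (u1 * v2 - u2 * v1) ^ 2 = 1 := by
    linear_combination (v1 ^ 2 + v2 ^ 2 + v3 ^ 2) * hu + hv - (u1 * v1 + u2 * v2 + u3 * v3) * huv
  have E1 : β * (u1 * v2 - u2 * v1) - c * (u3 * v1 - u1 * v3) = 0 := by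
    linear_combination u1 * hnv - v1 * hnu
  have E2 : c * (u2 * v3 - u3 * v2) - α * (u1 * v2 - u2 * v1) = 0 := by
    linear_combination u2 * hnv - v2 * hnu
  have E3 : α * (u3 * v1 - u1 * v3) - β * (u2 * v3 - u3 * v2) = 0 := by
    linear_combination u3 * hnv - v3 * hnu
  set w1 := u2 * v3 - u3 * v2 with hw1
  set w2 := u3 * v1 - u1 * v3 with hw2
  set w3 := u1 * v2 - u2 * v1 with hw3
  have Hc : c = (α * w1 + β * w2 + c * w3) * w3 := by
    linear_combination (-c) * hw + w1 * E2 - w2 * E1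
  have Ha : α = (α * w1 + β * w2 + c * w3) * w1 := by
    linear_combination (-α) * hw + w2 * E3 - w3 * E2
  have Hb : β = (α * w1 + β * w2 + c * w3) * w2 := by
    linear_combination (-β) * hw - w1 * E3 + w3 * E1
  have Hn : α ^ 2 + β ^ 2 + c ^ 2 = (α * w1 + β * w2 + c * w3) ^ 2 := by
    linear_combination α * Ha + β * Hb + c * Hc
  linear_combination w3 ^ 2 * Hn - ((α * w1 + β * w2 + c * w3) * w3 + c) * Hc

/-- Consequently `|u₁v₂ − u₂v₁| = |c|/√(α² + β² + c²)` when `c ≠ 0`.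
[cite: EvansGariepy2015, Thm 5.16 (Gauss–Green), facet charts — plumbing] -/
theorem abs_frameDet_eq (u1 u2 u3 v1 v2 v3 α β c : ℝ) (hc : c ≠ 0)
    (hu : u1 ^ 2 + u2 ^ 2 + u3 ^ 2 = 1) (hv : v1 ^ 2 + v2 ^ 2 + v3 ^ 2 = 1)
    (huv : u1 * v1 + u2 * v2 + u3 * v3 = 0)
    (hnu : α * u1 + β * u2 + c * u3 = 0) (hnv : α * v1 + β * v2 + c * v3 = 0) :
    |u1 * v2 - u2 * v1| = |c| / Real.sqrt (α ^ 2 + β ^ 2 + c ^ 2) := by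
  have hN : 0 < α ^ 2 + β ^ 2 + c ^ 2 := by positivity
  have hsN : 0 < Real.sqrt (α ^ 2 + β ^ 2 + c ^ 2) := Real.sqrt_pos.2 hN
  have key := sq_frameDet_mul_normSq u1 u2 u3 v1 v2 v3 α β c hu hv huv hnu hnv
  rw [eq_div_iff hsN.ne']
  have h1 : (|u1 * v2 - u2 * v1| * Real.sqrt (α ^ 2 + β ^ 2 + c ^ 2)) ^ 2 = |c| ^ 2 := by
    rw [mul_pow, sq_abs, sq_abs, Real.sq_sqrt hN.le, key]
  exact (pow_left_inj₀ (by positivity) (abs_nonneg c) two_ne_zero).1 h1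

/-! ### Affine change of variables on `ℝ × ℝ` -/

/-- `∫ H = |det S| · ∫ H(p + S y) dy` for a linear automorphism `S` of `ℝ × ℝ` and a translation `p`.
[cite: EvansGariepy2015, Thm 3.8 (change of variables), affine case] -/
theorem integral_eq_abs_det_mul_integral_comp_add (S : (ℝ × ℝ) ≃L[ℝ] (ℝ × ℝ)) (p : ℝ × ℝ)
    (H : ℝ × ℝ → ℝ) :
    ∫ x, H x = |(S : (ℝ × ℝ) →L[ℝ] (ℝ × ℝ)).det| * ∫ y, H (p + S y) := by
  haveI : (volume : Measure (ℝ × ℝ)).IsAddHaarMeasure := by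
    rw [Measure.volume_eq_prod]; infer_instance
  set f : ℝ × ℝ → ℝ × ℝ := fun y ↦ p + S y with hf
  have hderiv : ∀ y ∈ (univ : Set (ℝ × ℝ)),
      HasFDerivWithinAt f (S : (ℝ × ℝ) →L[ℝ] (ℝ × ℝ)) univ y := by
    intro y _
    exact ((S : (ℝ × ℝ) →L[ℝ] (ℝ × ℝ)).hasFDerivAt.const_add p).hasFDerivWithinAt
  have hinj : InjOn f univ := by
    intro a _ b _ hab
    exact S.injective (add_left_cancel hab)
  have himage : f '' univ = univ := by
    refine eq_univ_of_forall (fun x ↦ ⟨S.symm (x - p), mem_univ _, ?_⟩)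
    simp [hf]
  have h := integral_image_eq_integral_abs_det_fderiv_smul volume MeasurableSet.univ hderiv hinj H
  rw [himage, Measure.restrict_univ] at h
  rw [h, ← integral_const_mul]
  rfl

/-! ### Graph integral = `|c|/‖n‖` × chart integral -/

/-- **Brick L4.**  Let `Π = {(x, t) | α x₁ + β x₂ + c t = b}` with `c ≠ 0`, `p₀ ∈ Π`, and `u, v` an
orthonormal pair of directions of `Π` (in coordinates: unit length, `u ⊥ v`, both orthogonal to
`n = (α, β, c)`); put `φ y = p₀ + y₁•u + y₂•v` (an isometric chart of `Π`).  Then for every measurable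
`S ⊆ ℝ × ℝ` and every `g`:
`∫_{x ∈ S} g(x, (b − αx₁ − βx₂)/c) dx = (|c|/√(α²+β²+c²)) · ∫ 1_S((φ y).1) · g(φ y) dy`.
[cite: EvansGariepy2015, Thm 5.16 (Gauss–Green), polyhedral case — graph integral versus surface chart] -/
theorem setIntegral_graph_eq_mul_integral_chart {α β c b : ℝ} (hc : c ≠ 0)
    (p₀ u v : (ℝ × ℝ) × ℝ) (hp₀ : α * p₀.1.1 + β * p₀.1.2 + c * p₀.2 = b)
    (hnu : α * u.1.1 + β * u.1.2 + c * u.2 = 0) (hnv : α * v.1.1 + β * v.1.2 + c * v.2 = 0)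
    (hu : u.1.1 ^ 2 + u.1.2 ^ 2 + u.2 ^ 2 = 1) (hv : v.1.1 ^ 2 + v.1.2 ^ 2 + v.2 ^ 2 = 1)
    (huv : u.1.1 * v.1.1 + u.1.2 * v.1.2 + u.2 * v.2 = 0)
    {S : Set (ℝ × ℝ)} (hS : MeasurableSet S) (g : (ℝ × ℝ) × ℝ → ℝ) :
    ∫ x in S, g (x, (b - α * x.1 - β * x.2) / c) =
      |c| / Real.sqrt (α ^ 2 + β ^ 2 + c ^ 2) *
        ∫ y : ℝ × ℝ, S.indicator (fun _ => (1 : ℝ)) (p₀ + y.1 • u + y.2 • v).1 *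
          g (p₀ + y.1 • u + y.2 • v) := by
  -- the projected frame as a linear automorphism of `ℝ × ℝ`
  set L := Matrix.toLin (Module.Basis.finTwoProd ℝ) (Module.Basis.finTwoProd ℝ)
    !![u.1.1, v.1.1; u.1.2, v.1.2] with hL
  have hdetL : LinearMap.det L = u.1.1 * v.1.2 - v.1.1 * u.1.2 := by
    rw [hL, LinearMap.det_toLin, Matrix.det_fin_two_of]
  have key := sq_frameDet_mul_normSq u.1.1 u.1.2 u.2 v.1.1 v.1.2 v.2 α β c hu hv huv hnu hnv
  have hN : 0 < α ^ 2 + β ^ 2 + c ^ 2 := by positivity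
  have hdet0 : u.1.1 * v.1.2 - u.1.2 * v.1.1 ≠ 0 := by
    intro h0
    rw [h0] at key
    have : c ^ 2 = 0 := by nlinarith
    exact hc (pow_eq_zero_iff two_ne_zero |>.1 this)
  have hdetL0 : LinearMap.det L ≠ 0 := by
    rw [hdetL]; intro h; exact hdet0 (by linarith)
  set E := (LinearMap.equivOfDetNeZero L hdetL0).toContinuousLinearEquiv with hE
  have happ : ∀ y : ℝ × ℝ, E y = y.1 • u.1 + y.2 • v.1 := by
    intro y
    show L y = _
    rw [hL, Matrix.toLin_finTwoProd_apply]
    ext <;> simp [smul_eq_mul] <;> ring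
  have hdetE : (E : (ℝ × ℝ) →L[ℝ] (ℝ × ℝ)).det = u.1.1 * v.1.2 - v.1.1 * u.1.2 := by
    rw [← hdetL]; rfl
  -- the graph integrand as an indicator
  set H : ℝ × ℝ → ℝ := S.indicator (fun x => g (x, (b - α * x.1 - β * x.2) / c)) with hH
  have hLHS : ∫ x in S, g (x, (b - α * x.1 - β * x.2) / c) = ∫ x, H x := by
    rw [hH, integral_indicator hS]
  -- change of variables `x = p₀.1 + E y`
  have hcov := integral_eq_abs_det_mul_integral_comp_add E p₀.1 H
  -- the chart point lies on the plane: its height is the graph value at its projection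
  have hchart : ∀ y : ℝ × ℝ, ((p₀ + y.1 • u + y.2 • v).1,
      (b - α * (p₀ + y.1 • u + y.2 • v).1.1 - β * (p₀ + y.1 • u + y.2 • v).1.2) / c) =
      p₀ + y.1 • u + y.2 • v := by
    intro y
    ext
    · rfl
    · rfl
    · simp only [Prod.fst_add, Prod.snd_add, Prod.smul_fst, Prod.smul_snd, smul_eq_mul]
      rw [div_eq_iff hc]
      linear_combination (-1 : ℝ) * hp₀ - y.1 * hnu - y.2 * hnv
  have hproj : ∀ y : ℝ × ℝ, p₀.1 + E y = (p₀ + y.1 • u + y.2 • v).1 := by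
    intro y; rw [happ, Prod.fst_add, Prod.fst_add, Prod.smul_fst, Prod.smul_fst, add_assoc]
  have hint : ∀ y : ℝ × ℝ, H (p₀.1 + E y) =
      S.indicator (fun _ => (1 : ℝ)) (p₀ + y.1 • u + y.2 • v).1 * g (p₀ + y.1 • u + y.2 • v) := by
    intro y
    rw [hproj, hH]
    by_cases hy : (p₀ + y.1 • u + y.2 • v).1 ∈ S
    · rw [indicator_of_mem hy, indicator_of_mem hy, one_mul]
      exact congrArg g (hchart y)
    · rw [indicator_of_notMem hy, indicator_of_notMem hy, zero_mul]
  rw [hLHS, hcov, hdetE]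
  have habs : |u.1.1 * v.1.2 - v.1.1 * u.1.2| = |c| / Real.sqrt (α ^ 2 + β ^ 2 + c ^ 2) := by
    rw [show u.1.1 * v.1.2 - v.1.1 * u.1.2 = u.1.1 * v.1.2 - u.1.2 * v.1.1 by ring]
    exact abs_frameDet_eq u.1.1 u.1.2 u.2 v.1.1 v.1.2 v.2 α β c hc hu hv huv hnu hnv
  rw [habs]
  congr 1
  exact integral_congr_ae (Filter.Eventually.of_forall hint)

end Literature.MeasureTheory.Integral

end
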